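import Mathlib
import Literature.AlgebraicGeometry.Resolution.TaylorOrderBound
import HarnessLib

/-!
# Near points of the plane, I: lemmas (the plane as `k[X][Y]`, kernels of substitutions, cancellation in `(a, b)^n`, primes of the plane)

Topic: `Literature/AlgebraicGeometry/Resolution`. Elementary commutative algebra of the
polynomial ring in two variables `A = k[T_1, T_2]` over an arbitrary field `k`, used in
`PlaneNearPoints.lean` to prove the `ℙ²`-case of Hironaka's theorem on near points
([CoP1] = Cossart–Piltant, J. Algebra 320 (2008), proof of Prop. 4.2, p. 8: "By Hironaka's
theorem 2 [25], `x′ ∈ Proj(Dir_x(E))` … This holds if `k` is perfect or if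
`char(k) ≥ dim(C_x(E))` which is the case here, since `dim R = 3`"):

* `planeEquiv : k[T_1, T_2] ≃ₐ[k] k[X][Y]` (`T_1 ↦ Y`, `T_2 ↦ C X`) and the kernels of the two
  substitutions used in the proof: `ker_aeval_vecCons_X` — `ker (T_1 ↦ h(X), T_2 ↦ X) = (T_1 − h(T_2))`;
  `ker_aeval_vecCons_C` — `ker (T_1 ↦ X, T_2 ↦ t) = (π(T_2))`, `π` the minimal polynomial of `t`;
* degree bounds: `natDegree_aeval_le_mul_totalDegree`, `totalDegree_toMvPolynomial_le'`,
  `totalDegree_pow_of_isDomain`, and the order bound `le_totalDegree_of_mul_mem_pow`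
  (`s g ∈ 𝔮^e`, `s ∉ 𝔮`, `g ≠ 0 ⇒ e ≤ deg g`, from `TaylorOrderBound`);
* the cancellation lemma `mem_span_pair_pow_of_mul_mem`: `(a)` prime, `b ∉ (a)`, `a ≠ 0`,
  `a w ∈ (a, b)^{n+1} ⇒ w ∈ (a, b)^n`;
* `eq_bot_or_eq_span_or_isMaximal`: a prime of `k[T_1, T_2]` is `0`, principal, or maximal
  (UFD of dimension two), and `isIntegral_quotient_mk_X` (Nullstellensatz);
* `affineLinearIn 𝔮 = U′(𝔮)`: the `k`-space of affine-linear polynomials in `𝔮`, with its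
  submodule powers `U′(𝔮)^n ⊆ A`.

## Sources

* V. Cossart, O. Piltant, J. Algebra 320 (2008) 1051–1082, proof of Prop. 4.2 and Lemma 4.3,
  p. 8. [CossartPiltant2008]
* H. Hironaka, *Additive groups associated with points of a projective space*, Ann. of Math. 92
  (1970) 327–334, Thm. 2 — the statement generalised; the proofs here are elementary and ours.
-/

open MvPolynomial Polynomial

noncomputable section

namespace Literature.AlgebraicGeometry.Resolution

universe u

variable (k : Type u) [Field k]

/-! ## The plane as `k[X][Y]` -/

/-- `k[T_1, T_2] ≃ₐ k[X][Y]` with `T_1 ↦ Y` (outer variable), `T_2 ↦ C X` (inner variable).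
[folklore] -/
noncomputable def planeEquiv : MvPolynomial (Fin 2) k ≃ₐ[k] Polynomial (Polynomial k) :=
  (MvPolynomial.finSuccEquiv k 1).trans (Polynomial.mapAlgEquiv (MvPolynomial.uniqueAlgEquiv k (Fin 1)))

/-- `Ψ(T_1) = Y`. [folklore] -/
theorem planeEquiv_X_zero : planeEquiv k (X 0) = Polynomial.X := by
  simp [planeEquiv, finSuccEquiv_X_zero]

/-- `Ψ(T_2) = C X`. [folklore] -/
theorem planeEquiv_X_one : planeEquiv k (X 1) = Polynomial.C Polynomial.X := by
  have h1 : (X 1 : MvPolynomial (Fin 2) k) = X (Fin.succ 0) := rfl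
  rw [planeEquiv, AlgEquiv.trans_apply, h1, finSuccEquiv_X_succ]
  simp [Polynomial.mapAlgEquiv, uniqueAlgEquiv]

/-- `Ψ⁻¹(Y) = T_1`. [folklore] -/
theorem planeEquiv_symm_X : (planeEquiv k).symm Polynomial.X = X 0 := by
  rw [AlgEquiv.symm_apply_eq, planeEquiv_X_zero]

/-- `Ψ(p(T_2)) = C p`. [folklore] -/
theorem planeEquiv_toMvPolynomial (p : Polynomial k) :
    planeEquiv k (p.toMvPolynomial 1) = Polynomial.C p := by
  have : (planeEquiv k).toAlgHom.comp (Polynomial.toMvPolynomial (1 : Fin 2)) =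
      (Polynomial.CAlgHom : Polynomial k →ₐ[k] Polynomial (Polynomial k)) := by
    refine Polynomial.algHom_ext ?_
    simp only [AlgHom.coe_comp, Function.comp_apply, Polynomial.CAlgHom_apply,
      Polynomial.toMvPolynomial_X]
    exact planeEquiv_X_one k
  exact AlgHom.congr_fun this p

/-- `Ψ⁻¹(C p) = p(T_2)`. [folklore] -/
theorem planeEquiv_symm_C (p : Polynomial k) :
    (planeEquiv k).symm (Polynomial.C p) = p.toMvPolynomial 1 := by
  rw [AlgEquiv.symm_apply_eq, planeEquiv_toMvPolynomial]



/-- `ev″_h(p) = (Ψ p)(Y := h)`: the substitution `T_1 ↦ h(X), T_2 ↦ X` read through `Ψ`.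
[folklore] -/
theorem aeval_vecCons_X_eq (h : Polynomial k) (p : MvPolynomial (Fin 2) k) :
    MvPolynomial.aeval ![h, Polynomial.X] p = Polynomial.eval h (planeEquiv k p) := by
  have : (MvPolynomial.aeval ![h, Polynomial.X] : MvPolynomial (Fin 2) k →ₐ[k] Polynomial k) =
      ((Polynomial.aeval h : Polynomial (Polynomial k) →ₐ[Polynomial k] Polynomial k).restrictScalars
        k).comp (planeEquiv k).toAlgHom := by
    refine MvPolynomial.algHom_ext fun i => ?_
    fin_cases i
    · simp [planeEquiv_X_zero]
    · simp [planeEquiv_X_one]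
  rw [this]
  simp

/-- **`ker ev″_h = (T_1 − h(T_2))`.** [folklore] -/
theorem ker_aeval_vecCons_X (h : Polynomial k) :
    RingHom.ker (MvPolynomial.aeval ![h, Polynomial.X] : MvPolynomial (Fin 2) k →ₐ[k] Polynomial k) =
      Ideal.span {X 0 - h.toMvPolynomial 1} := by
  have hspan : Ideal.span {(X 0 - h.toMvPolynomial 1 : MvPolynomial (Fin 2) k)} =
      (Ideal.span {Polynomial.X - Polynomial.C h}).comap (planeEquiv k).toRingEquiv := by
    rw [← Ideal.map_symm, Ideal.map_span, Set.image_singleton, ← AlgEquiv.symm_toRingEquiv]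
    congr 2
    change _ = (planeEquiv k).symm (Polynomial.X - Polynomial.C h)
    rw [map_sub, planeEquiv_symm_X, planeEquiv_symm_C]
  ext p
  rw [RingHom.mem_ker, hspan, Ideal.mem_comap, ← Polynomial.ker_evalRingHom, RingHom.mem_ker,
    Polynomial.coe_evalRingHom]
  exact (aeval_vecCons_X_eq k h p).congr_left

/-- `ev′_t(p) = (Ψ p)` with coefficients evaluated at `t`: `T_1 ↦ X`, `T_2 ↦ t`. [folklore] -/
theorem aeval_vecCons_C_eq {K' : Type*} [CommRing K'] [Algebra k K'] (t : K')
    (p : MvPolynomial (Fin 2) k) :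
    MvPolynomial.aeval ![Polynomial.X, Polynomial.C t] p =
      Polynomial.map (Polynomial.aeval t : Polynomial k →ₐ[k] K').toRingHom (planeEquiv k p) := by
  have : (MvPolynomial.aeval ![Polynomial.X, Polynomial.C t] : MvPolynomial (Fin 2) k →ₐ[k] Polynomial K') =
      (Polynomial.mapAlgHom (Polynomial.aeval t : Polynomial k →ₐ[k] K')).comp (planeEquiv k).toAlgHom := by
    refine MvPolynomial.algHom_ext fun i => ?_
    fin_cases i
    · simp [planeEquiv_X_zero, Polynomial.mapAlgHom]
    · simp [planeEquiv_X_one, Polynomial.mapAlgHom]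
  rw [this]
  simp [Polynomial.mapAlgHom]

/-- **`ker ev′_t = (π(T_2))`, `π` the minimal polynomial of `t`** (`t` in a field extension of `k`).
[folklore] -/
theorem ker_aeval_vecCons_C {K' : Type*} [Field K'] [Algebra k K'] (t : K') :
    RingHom.ker (MvPolynomial.aeval ![Polynomial.X, Polynomial.C t] :
        MvPolynomial (Fin 2) k →ₐ[k] Polynomial K') =
      Ideal.span {(minpoly k t).toMvPolynomial 1} := by
  have hspan : Ideal.span {((minpoly k t).toMvPolynomial 1 : MvPolynomial (Fin 2) k)} =
      ((RingHom.ker (Polynomial.aeval t : Polynomial k →ₐ[k] K')).map Polynomial.C).comap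
        (planeEquiv k).toRingEquiv := by
    rw [minpoly.ker_aeval_eq_span_minpoly, Ideal.submodule_span_eq, Ideal.map_span,
      Set.image_singleton, ← Ideal.map_symm, Ideal.map_span, Set.image_singleton,
      ← AlgEquiv.symm_toRingEquiv]
    congr 2
    exact (planeEquiv_symm_C k _).symm
  ext p
  rw [RingHom.mem_ker, hspan, Ideal.mem_comap, aeval_vecCons_C_eq, Ideal.mem_map_C_iff,
    Polynomial.ext_iff]
  refine forall_congr' fun n => ?_
  rw [Polynomial.coeff_map, Polynomial.coeff_zero, RingHom.mem_ker]
  rfl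


/-! ## Degree bounds -/

/-- **`deg p(f) ≤ D · deg p`** for a substitution `T_i ↦ f_i` by polynomials of degree `≤ D`.
[folklore] -/
theorem natDegree_aeval_le_mul_totalDegree {σ : Type*} {K' : Type*} [CommRing K'] [Algebra k K']
    (f : σ → Polynomial K') {D : ℕ} (hf : ∀ i, (f i).natDegree ≤ D) (p : MvPolynomial σ k) :
    (MvPolynomial.aeval f p).natDegree ≤ D * p.totalDegree := by
  rw [MvPolynomial.aeval_def, MvPolynomial.eval₂_eq]
  refine Polynomial.natDegree_sum_le_of_forall_le _ _ fun m hm => ?_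
  refine Polynomial.natDegree_mul_le.trans ?_
  rw [Polynomial.algebraMap_apply, Polynomial.natDegree_C, zero_add]
  refine (Polynomial.natDegree_prod_le _ _).trans ?_
  calc ∑ i ∈ m.support, ((f i) ^ (m i)).natDegree
      ≤ ∑ i ∈ m.support, D * m i := Finset.sum_le_sum fun i _ =>
        Polynomial.natDegree_pow_le.trans (by rw [mul_comm (m i)]; exact Nat.mul_le_mul_right _ (hf i))
    _ = D * ∑ i ∈ m.support, m i := (Finset.mul_sum _ _ _).symm
    _ ≤ D * p.totalDegree := Nat.mul_le_mul_left _ (MvPolynomial.le_totalDegree hm)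

/-- `deg π(T_i) ≤ deg π`. [folklore] -/
theorem totalDegree_toMvPolynomial_le' {σ : Type*} (π : Polynomial k) (i : σ) :
    (π.toMvPolynomial i).totalDegree ≤ π.natDegree := by
  rw [Polynomial.toMvPolynomial, Polynomial.aeval_eq_sum_range]
  refine (MvPolynomial.totalDegree_finsetSum _ _).trans (Finset.sup_le fun n hn => ?_)
  refine (MvPolynomial.totalDegree_smul_le _ _).trans ((MvPolynomial.totalDegree_X_pow _ _).le.trans ?_)
  exact Nat.lt_succ_iff.mp (Finset.mem_range.mp hn)

/-- `deg p^n = n · deg p` over a domain. [folklore] -/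
theorem totalDegree_pow_of_isDomain {σ : Type*} {p : MvPolynomial σ k} (hp : p ≠ 0) (n : ℕ) :
    (p ^ n).totalDegree = n * p.totalDegree := by
  induction n with
  | zero => rw [pow_zero, MvPolynomial.totalDegree_one, zero_mul]
  | succ n ih =>
    rw [pow_succ, MvPolynomial.totalDegree_mul_of_isDomain (pow_ne_zero _ hp) hp, ih]
    ring

/-- **`ord_𝔮 g ≤ deg g`** in the form used here: if `s g ∈ 𝔮^e` with `s ∉ 𝔮` and `g ≠ 0` then
`e ≤ deg g` (`TaylorOrderBound`). [cite: CossartPiltant2008, proof of Prop. 4.2 (a)] -/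
theorem le_totalDegree_of_mul_mem_pow {σ : Type*} (𝔮 : Ideal (MvPolynomial σ k)) [𝔮.IsPrime]
    {s g : MvPolynomial σ k} (hs : s ∉ 𝔮) {e : ℕ} (hsg : s * g ∈ 𝔮 ^ e) (hg : g ≠ 0) :
    e ≤ g.totalDegree := by
  by_contra hlt
  rw [not_le] at hlt
  refine algebraMap_mvPolynomial_not_mem_maximalIdeal_pow 𝔮 (Localization.AtPrime 𝔮) hg hlt ?_
  have hu : IsUnit (algebraMap (MvPolynomial σ k) (Localization.AtPrime 𝔮) s) :=
    IsLocalization.map_units (Localization.AtPrime 𝔮) (⟨s, hs⟩ : 𝔮.primeCompl)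
  have hmem : algebraMap (MvPolynomial σ k) (Localization.AtPrime 𝔮) (s * g) ∈
      IsLocalRing.maximalIdeal (Localization.AtPrime 𝔮) ^ e := by
    rw [← Localization.AtPrime.map_eq_maximalIdeal, ← Ideal.map_pow]
    exact Ideal.mem_map_of_mem _ hsg
  rw [map_mul] at hmem
  exact (Ideal.unit_mul_mem_iff_mem _ hu).mp hmem

/-! ## The cancellation lemma for `(a, b)^n` -/

/-- `(a, b)^{n+1} ⊆ a·(a, b)^n + (b^{n+1})`. [folklore] -/
theorem span_pair_pow_succ_le {R : Type*} [CommRing R] (a b : R) (n : ℕ) :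
    Ideal.span {a, b} ^ (n + 1) ≤ Ideal.span {a} * Ideal.span {a, b} ^ n ⊔ Ideal.span {b ^ (n + 1)} := by
  induction n with
  | zero =>
    rw [pow_one, pow_zero, mul_one, zero_add, pow_one, Ideal.span_insert]
  | succ n ih =>
    have hP : Ideal.span {a, b} = Ideal.span {a} ⊔ Ideal.span {b} := Ideal.span_insert _ _
    have ha : a ∈ Ideal.span {a, b} := Ideal.subset_span (by simp)
    have hb : b ∈ Ideal.span {a, b} := Ideal.subset_span (by simp)
    calc Ideal.span {a, b} ^ (n + 1 + 1) = Ideal.span {a, b} ^ (n + 1) * Ideal.span {a, b} := pow_succ _ _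
      _ ≤ (Ideal.span {a} * Ideal.span {a, b} ^ n ⊔ Ideal.span {b ^ (n + 1)}) *
            (Ideal.span {a} ⊔ Ideal.span {b}) := by rw [← hP]; exact Ideal.mul_mono_left ih
      _ ≤ Ideal.span {a} * Ideal.span {a, b} ^ (n + 1) ⊔ Ideal.span {b ^ (n + 1 + 1)} := by
        rw [Ideal.sup_mul, Ideal.mul_sup, Ideal.mul_sup]
        refine sup_le (sup_le ?_ ?_) (sup_le ?_ ?_)
        · rw [mul_assoc]
          refine le_sup_of_le_left (Ideal.mul_mono_right ?_)
          rw [pow_succ]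
          exact Ideal.mul_mono_right (Ideal.span_singleton_le_iff_mem _ |>.mpr ha)
        · rw [mul_assoc]
          refine le_sup_of_le_left (Ideal.mul_mono_right ?_)
          rw [pow_succ]
          exact Ideal.mul_mono_right (Ideal.span_singleton_le_iff_mem _ |>.mpr hb)
        · rw [mul_comm]
          refine le_sup_of_le_left (Ideal.mul_mono_right ?_)
          rw [Ideal.span_singleton_le_iff_mem]
          exact Ideal.pow_mem_pow hb _
        · rw [Ideal.span_singleton_mul_span_singleton, ← pow_succ]
          exact le_sup_right

/-- **Cancellation**: in a domain, if `(a)` is prime, `b ∉ (a)` and `a ≠ 0`, then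
`a w ∈ (a, b)^{n+1} ⇒ w ∈ (a, b)^n` (reduce modulo `a`: the term `c b^{n+1}` has `c ∈ (a)`).
[folklore] -/
theorem mem_span_pair_pow_of_mul_mem {R : Type*} [CommRing R] [IsDomain R] {a b : R}
    (hpa : (Ideal.span {a}).IsPrime) (hb : b ∉ Ideal.span {a}) (ha : a ≠ 0) {n : ℕ} {w : R}
    (h : a * w ∈ Ideal.span {a, b} ^ (n + 1)) : w ∈ Ideal.span {a, b} ^ n := by
  obtain ⟨y, hy, z, hz, hyz⟩ := Submodule.mem_sup.mp (span_pair_pow_succ_le a b n h)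
  obtain ⟨v, hv, rfl⟩ := Ideal.mem_span_singleton_mul.mp hy
  obtain ⟨c, rfl⟩ := Ideal.mem_span_singleton'.mp hz
  have hc : c * b ^ (n + 1) ∈ Ideal.span {a} := by
    rw [show c * b ^ (n + 1) = a * (w - v) by rw [mul_sub, ← hyz]; ring]
    exact Ideal.mul_mem_right _ _ (Ideal.mem_span_singleton_self a)
  rcases hpa.mem_or_mem hc with hc | hc
  · obtain ⟨c', rfl⟩ := Ideal.mem_span_singleton'.mp hc
    have hw : w = v + c' * b ^ (n + 1) :=
      mul_left_cancel₀ ha (by rw [← hyz]; ring)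
    rw [hw]
    refine Ideal.add_mem _ hv (Ideal.mul_mem_left _ _ (Ideal.pow_le_pow_right (Nat.le_succ n) ?_))
    exact Ideal.pow_mem_pow (Ideal.subset_span (by simp)) _
  · exact absurd (hpa.mem_of_pow_mem _ hc) hb

/-! ## Primes of the plane: `0`, principal, or maximal -/

/-- **The primes of `k[T_1, T_2]`** are `0`, the principal primes `(π)`, and the maximal ideals
(`k[T_1, T_2]` is a UFD of dimension two). [folklore] -/
theorem eq_bot_or_eq_span_or_isMaximal (𝔮 : Ideal (MvPolynomial (Fin 2) k)) [𝔮.IsPrime] :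
    𝔮 = ⊥ ∨ (∃ π, Prime π ∧ 𝔮 = Ideal.span {π}) ∨ 𝔮.IsMaximal := by
  by_cases h0 : 𝔮 = ⊥
  · exact Or.inl h0
  obtain ⟨π, hπ𝔮, hπ⟩ := Ideal.IsPrime.exists_mem_prime_of_ne_bot ‹_› h0
  by_cases h1 : 𝔮 = Ideal.span {π}
  · exact Or.inr (Or.inl ⟨π, hπ, h1⟩)
  refine Or.inr (Or.inr ?_)
  have hdim : ringKrullDim (MvPolynomial (Fin 2) k) = (2 : ℕ) := by
    rw [MvPolynomial.ringKrullDim_of_isNoetherianRing, ringKrullDim_eq_zero_of_field]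
    simp
  haveI : FiniteRingKrullDim (MvPolynomial (Fin 2) k) :=
    finiteRingKrullDim_iff_ne_bot_and_top.mpr
      ⟨by rw [hdim]; exact WithBot.natCast_ne_bot 2, by rw [hdim]; exact ne_of_lt (WithBot.coe_lt_coe.mpr (ENat.coe_lt_top 2))⟩
  haveI hπp : (Ideal.span {π}).IsPrime := (Ideal.span_singleton_prime hπ.ne_zero).mpr hπ
  have hlt1 : (⊥ : Ideal (MvPolynomial (Fin 2) k)) < Ideal.span {π} :=
    bot_lt_iff_ne_bot.mpr (by rw [Ne, Ideal.span_singleton_eq_bot]; exact hπ.ne_zero)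
  have hlt2 : Ideal.span {π} < 𝔮 :=
    lt_of_le_of_ne ((Ideal.span_singleton_le_iff_mem _).mpr hπ𝔮) (Ne.symm h1)
  have h1' := Ideal.height_strict_mono_of_isPrime hlt1
  have h2' := Ideal.height_strict_mono_of_isPrime hlt2
  rw [Ideal.height_bot] at h1'
  have hle : (𝔮.height : WithBot ℕ∞) ≤ ringKrullDim (MvPolynomial (Fin 2) k) :=
    Ideal.height_le_ringKrullDim_of_isPrime
  refine Ideal.isMaximal_of_height_eq_ringKrullDim (le_antisymm hle ?_)
  rw [hdim]
  have h2 : (2 : ℕ∞) ≤ 𝔮.height := by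
    have : (1 : ℕ∞) ≤ (Ideal.span {π}).height := Order.one_le_iff_pos.mpr h1'
    calc (2 : ℕ∞) = 1 + 1 := by norm_num
      _ ≤ (Ideal.span {π}).height + 1 := add_le_add this le_rfl
      _ ≤ 𝔮.height := Order.add_one_le_of_lt h2'
  calc ((2 : ℕ) : WithBot ℕ∞) = ((2 : ℕ∞) : WithBot ℕ∞) := by norm_cast
    _ ≤ 𝔮.height := WithBot.coe_le_coe.mpr h2

/-- For a maximal ideal `𝔮` of `k[T_1, T_2]`, the residue field is algebraic over `k`
(Nullstellensatz). [folklore] -/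
theorem isIntegral_quotient_mk_X (𝔮 : Ideal (MvPolynomial (Fin 2) k)) [𝔮.IsMaximal] (i : Fin 2) :
    IsIntegral k (Ideal.Quotient.mk 𝔮 (X i : MvPolynomial (Fin 2) k)) :=
  MvPolynomial.quotient_mk_comp_C_isIntegral_of_isJacobsonRing 𝔮 _


/-! ## `U′(𝔮)`: the affine-linear elements of `𝔮` -/

variable {k}

/-- **`U′(𝔮)`**: the `k`-space of affine-linear polynomials (total degree `≤ 1`) lying in the
ideal `𝔮` — for a point `x′` of the affine chart, the `k`-rational (affine) lines through `x′`.
[folklore] -/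
def affineLinearIn {σ : Type*} (𝔮 : Ideal (MvPolynomial σ k)) : Submodule k (MvPolynomial σ k) :=
  MvPolynomial.restrictTotalDegree σ k 1 ⊓ 𝔮.restrictScalars k

/-- Membership in `U′(𝔮)`. [folklore] -/
theorem mem_affineLinearIn_iff {σ : Type*} {𝔮 : Ideal (MvPolynomial σ k)} {p : MvPolynomial σ k} :
    p ∈ affineLinearIn 𝔮 ↔ p.totalDegree ≤ 1 ∧ p ∈ 𝔮 := by
  simp only [affineLinearIn, Submodule.mem_inf, MvPolynomial.mem_restrictTotalDegree,
    Submodule.restrictScalars_mem]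

/-- Constants lie in `U′(𝔮)^0 = k`. [folklore] -/
theorem mem_affineLinearIn_pow_zero {σ : Type*} (𝔮 : Ideal (MvPolynomial σ k))
    {g : MvPolynomial σ k} (hg : g.totalDegree ≤ 0) : g ∈ affineLinearIn 𝔮 ^ 0 := by
  rw [pow_zero, Submodule.mem_one]
  exact ⟨g.coeff 0, by
    rw [MvPolynomial.algebraMap_eq]
    exact (MvPolynomial.totalDegree_eq_zero_iff_eq_C.mp (Nat.le_zero.mp hg)).symm⟩

/-- `c · p^n ∈ U′(𝔮)^n` for `p ∈ U′(𝔮)`. [folklore] -/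
theorem C_mul_pow_mem_affineLinearIn_pow {σ : Type*} {𝔮 : Ideal (MvPolynomial σ k)}
    {p : MvPolynomial σ k} (hp : p ∈ affineLinearIn 𝔮) (c : k) (n : ℕ) :
    MvPolynomial.C c * p ^ n ∈ affineLinearIn 𝔮 ^ n := by
  rw [MvPolynomial.C_mul']
  exact Submodule.smul_mem _ c (Submodule.pow_mem_pow _ hp n)

/-- `q · p ∈ U′(𝔮)^{n+1}` for `q ∈ U′(𝔮)^n`, `p ∈ U′(𝔮)`. [folklore] -/
theorem mul_mem_affineLinearIn_pow_succ {σ : Type*} {𝔮 : Ideal (MvPolynomial σ k)} {n : ℕ}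
    {p q : MvPolynomial σ k} (hq : q ∈ affineLinearIn 𝔮 ^ n) (hp : p ∈ affineLinearIn 𝔮) :
    q * p ∈ affineLinearIn 𝔮 ^ (n + 1) := by
  rw [pow_succ]
  exact Submodule.mul_mem_mul hq hp

end Literature.AlgebraicGeometry.Resolution

end
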